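/-
Copyright (c) 2026. All rights reserved.
Released under Apache 2.0 license as described in the file LICENSE.
Authors: HodgeCM publication cell (pub/hodgecm-mathlib), Track B, seat K2E3-p25 (g0).
-/
import Summits.HodgeConjecture.HodgeConjecture.Theorems.K2E3GL3BruhatCellSubgroups        -- ★ E3β₁ (cell data, coordinates, membership)
import Literature.NumberTheory.Automorphic.TateLocalZetaShells                             -- ★ `map_mul_left_addHaar`
import HarnessLib

/-!
# K2_E3 road (h413), leaf (nsc-S-A′), brick E3β₂ — Haar measures on the cell subgroups `Γ_w ≤ U₃` in coordinates; torus and shear conjugations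
Cell `pub/hodgecm-mathlib` (D-0151), Track B, seat K2E3-p25 (g0).  `--supports stmt-HodgeConjecture-24833 --as helper`; THEOREMS ONLY; COUNT-NEUTRAL.
* §1 the diagonal torus `diag(m) = blockDiagonalGL F id m` of `GL₃`: `diag(m) = diagonal d`, and **`diag(m)⁻¹ e((x,y),z) diag(m) = e((x d₁/d₀, y d₂/d₁), z d₂/d₀)`**;
  the shears `s⁻¹ γ s` of `Γ = U_{Q′}` by `s ∈ U_{α₂}` and of `Γ = U_Q` by `s ∈ U_{α₁}`; entries of products in `U`.
* §2 coordinate homeomorphisms `F ≃ₜ U_{α₁}, U_{α₂}` and `F × F ≃ₜ U_Q, U_{Q′}` (existence form, through ★ `e`), additive.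
* §3 **transport of measures**: for an additive homeomorphism `φ : A ≃ₜ Γ` and a right-invariant measure `ν` on `A` finite on compacts and positive on opens, `φ_* ν` is a
  right-invariant measure on `Γ` finite on compacts and positive on opens (the three instance hypotheses of ★ E3γ2 `exists_lineFunctional_of_cellDatum`); scalings of
  `μ_F ⊗ μ_F`.
HONEST LABEL: HC_CM is proved only modulo the 7 printed citations (2 remaining named inputs: hLiu418 = stmt-HodgeConjecture-24832, h413 = stmt-HodgeConjecture-24833) until rung 0 closes.
## References
* [BernsteinZelevinsky1977] I. N. Bernstein, A. V. Zelevinsky, *Induced representations of reductive p-adic groups I*, Ann. Sci. ÉNS 10 (1977), §1.7–1.9, §2.1, Thm. 5.2.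
* [Casselman1995] W. Casselman, *Introduction to the theory of admissible representations of p-adic reductive groups* (draft 1995), §1.5, §6.3.
-/

set_option autoImplicit false
set_option linter.dupNamespace false

noncomputable section

open Set Function MeasureTheory Measure Filter
open scoped MatrixGroups NNReal ENNReal

namespace Summit.HodgeConjecture.HodgeConjecture.Cruxes.H413.K2E3GL3BruhatCellHaar

open Literature.NumberTheory.Automorphic
open Literature.NumberTheory.GaloisRepresentations Literature.NumberTheory.GaloisRepresentations.IsNonarchimedeanLocalField
open Summit.HodgeConjecture.HodgeConjecture.Cruxes.H413.K2E3GL3BorelUnipotentHaar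
open Summit.HodgeConjecture.HodgeConjecture.Cruxes.H413.K2E3GL3BruhatCellSubgroups

variable {F : Type} [Field F]

/-! ## §1 The diagonal torus of `GL₃`, conjugation in coordinates -/

/-- `diag(m) = blockDiagonalGL F id m` is the diagonal matrix of its diagonal entries `dᵢ = diag(m)ᵢᵢ`. [cite: BernsteinZelevinsky1977, §2.1] -/
theorem coe_blockDiagonalGL_id_three (m : Π a : Fin 3, GL {i : Fin 3 // (id : Fin 3 → Fin 3) i = a} F) :
    ((blockDiagonalGL F (id : Fin 3 → Fin 3) m : GL (Fin 3) F) : Matrix (Fin 3) (Fin 3) F) = Matrix.diagonal fun i => ((blockDiagonalGL F (id : Fin 3 → Fin 3) m : GL (Fin 3) F) : Matrix (Fin 3) (Fin 3) F) i i := by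
  ext i j
  by_cases hij : i = j
  · subst hij
    rw [Matrix.diagonal_apply_eq]
  · rw [Matrix.diagonal_apply_ne _ hij]
    exact K2E3BorelCellJacquetLine.blockDiagonalGL_id_apply_of_ne m hij

/-- The diagonal entries of `diag(m)` are non-zero. [folklore] -/
theorem blockDiagonalGL_id_three_apply_ne_zero (m : Π a : Fin 3, GL {i : Fin 3 // (id : Fin 3 → Fin 3) i = a} F) (i : Fin 3) :
    ((blockDiagonalGL F (id : Fin 3 → Fin 3) m : GL (Fin 3) F) : Matrix (Fin 3) (Fin 3) F) i i ≠ 0 := by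
  have hdet := (Matrix.GeneralLinearGroup.det (blockDiagonalGL F (id : Fin 3 → Fin 3) m)).ne_zero
  rw [Matrix.GeneralLinearGroup.val_det_apply, coe_blockDiagonalGL_id_three, Matrix.det_diagonal] at hdet
  exact (Finset.prod_ne_zero_iff.1 hdet) i (Finset.mem_univ i)

section Coord

variable [TopologicalSpace F]
  (e : (F × F) × F ≃ₜ ↥(unipotentRadicalGL F (id : Fin 3 → Fin 3)))
  (he : ∀ p : (F × F) × F, (((e p : ↥(unipotentRadicalGL F (id : Fin 3 → Fin 3))) : GL (Fin 3) F) : Matrix (Fin 3) (Fin 3) F) = !![1, p.1.1, p.2; 0, 1, p.1.2; 0, 0, 1])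
include he

/-- **Torus conjugation in coordinates**: `diag(m)⁻¹ · e((x,y),z) · diag(m) = e((x d₁/d₀, y d₂/d₁), z d₂/d₀)`, `dᵢ = diag(m)ᵢᵢ`. [cite: BernsteinZelevinsky1977, 1.7] [cite: Casselman1995, §1.5] -/
theorem blockDiagonalGL_inv_mul_coord_mul (m : Π a : Fin 3, GL {i : Fin 3 // (id : Fin 3 → Fin 3) i = a} F) (p : (F × F) × F) :
    (blockDiagonalGL F (id : Fin 3 → Fin 3) m)⁻¹ * ((e p : ↥(unipotentRadicalGL F (id : Fin 3 → Fin 3))) : GL (Fin 3) F) * blockDiagonalGL F (id : Fin 3 → Fin 3) m =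
      ((e ((p.1.1 * ((blockDiagonalGL F (id : Fin 3 → Fin 3) m : GL (Fin 3) F) : Matrix (Fin 3) (Fin 3) F) 1 1 / ((blockDiagonalGL F (id : Fin 3 → Fin 3) m : GL (Fin 3) F) : Matrix (Fin 3) (Fin 3) F) 0 0,
            p.1.2 * ((blockDiagonalGL F (id : Fin 3 → Fin 3) m : GL (Fin 3) F) : Matrix (Fin 3) (Fin 3) F) 2 2 / ((blockDiagonalGL F (id : Fin 3 → Fin 3) m : GL (Fin 3) F) : Matrix (Fin 3) (Fin 3) F) 1 1),
          p.2 * ((blockDiagonalGL F (id : Fin 3 → Fin 3) m : GL (Fin 3) F) : Matrix (Fin 3) (Fin 3) F) 2 2 / ((blockDiagonalGL F (id : Fin 3 → Fin 3) m : GL (Fin 3) F) : Matrix (Fin 3) (Fin 3) F) 0 0) : ↥(unipotentRadicalGL F (id : Fin 3 → Fin 3))) : GL (Fin 3) F) := by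
  have hd0 : ((blockDiagonalGL F (id : Fin 3 → Fin 3) m : GL (Fin 3) F) : Matrix (Fin 3) (Fin 3) F) 0 0 ≠ 0 := blockDiagonalGL_id_three_apply_ne_zero m 0
  have hd1 : ((blockDiagonalGL F (id : Fin 3 → Fin 3) m : GL (Fin 3) F) : Matrix (Fin 3) (Fin 3) F) 1 1 ≠ 0 := blockDiagonalGL_id_three_apply_ne_zero m 1
  have hd2 : ((blockDiagonalGL F (id : Fin 3 → Fin 3) m : GL (Fin 3) F) : Matrix (Fin 3) (Fin 3) F) 2 2 ≠ 0 := blockDiagonalGL_id_three_apply_ne_zero m 2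
  have hdiag := coe_blockDiagonalGL_id_three m
  -- `t⁻¹ u t = u' ↔ u t = t u'`
  rw [mul_assoc, inv_mul_eq_iff_eq_mul]
  apply Units.ext
  rw [Units.val_mul, Units.val_mul, he, he, hdiag]
  ext i j
  fin_cases i <;> fin_cases j <;> simp [Matrix.mul_apply, Matrix.diagonal] <;>
    (rw [← mul_div_assoc]; first | exact (mul_div_cancel_left₀ _ hd0).symm | exact (mul_div_cancel_left₀ _ hd1).symm)

/-- **Shear of `Γ = U_{Q′}` by `s = e((0,a),0) ∈ U_{α₂}`**: `s⁻¹ e((x,0),z) s = e((x,0), z + x a)`. [cite: BernsteinZelevinsky1977, Thm. 5.2] -/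
theorem rootGroup_oneTwo_inv_mul_coord_mul (a x z : F) :
    ((e ((0, a), 0) : ↥(unipotentRadicalGL F (id : Fin 3 → Fin 3))) : GL (Fin 3) F)⁻¹ * ((e ((x, 0), z) : ↥(unipotentRadicalGL F (id : Fin 3 → Fin 3))) : GL (Fin 3) F) * ((e ((0, a), 0) : ↥(unipotentRadicalGL F (id : Fin 3 → Fin 3))) : GL (Fin 3) F) = ((e ((x, 0), z + x * a) : ↥(unipotentRadicalGL F (id : Fin 3 → Fin 3))) : GL (Fin 3) F) := by
  rw [← Subgroup.coe_inv, ← Subgroup.coe_mul, ← Subgroup.coe_mul, coord_inv e he, coord_mul e he, coord_mul e he]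
  congr 2
  ext <;> simp

/-- **Shear of `Γ = U_Q` by `s = e((a,0),0) ∈ U_{α₁}`**: `s⁻¹ e((0,y),z) s = e((0,y), z − a y)`. [cite: BernsteinZelevinsky1977, Thm. 5.2] -/
theorem rootGroup_zeroOne_inv_mul_coord_mul (a y z : F) :
    ((e ((a, 0), 0) : ↥(unipotentRadicalGL F (id : Fin 3 → Fin 3))) : GL (Fin 3) F)⁻¹ * ((e ((0, y), z) : ↥(unipotentRadicalGL F (id : Fin 3 → Fin 3))) : GL (Fin 3) F) * ((e ((a, 0), 0) : ↥(unipotentRadicalGL F (id : Fin 3 → Fin 3))) : GL (Fin 3) F) = ((e ((0, y), z - a * y) : ↥(unipotentRadicalGL F (id : Fin 3 → Fin 3))) : GL (Fin 3) F) := by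
  rw [← Subgroup.coe_inv, ← Subgroup.coe_mul, ← Subgroup.coe_mul, coord_inv e he, coord_mul e he, coord_mul e he]
  congr 2
  ext <;> simp; ring

/-! ## §2 Coordinate homeomorphisms onto `U_{α₁}, U_{α₂}, U_Q, U_{Q′}` (additive) -/

/-- `F ≃ₜ U_{α₁}`, `x ↦ e((x,0),0)`, additive. [cite: BernsteinZelevinsky1977, §2.1] -/
theorem exists_homeomorph_rootGroup_zeroOne :
    ∃ φ : F ≃ₜ ↥(unipotentRadicalGL F (![false, true, true] : Fin 3 → Bool) ⊓ standardLeviGL F (![false, false, true] : Fin 3 → Bool)),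
      (∀ x, ((φ x : ↥(unipotentRadicalGL F (![false, true, true] : Fin 3 → Bool) ⊓ standardLeviGL F (![false, false, true] : Fin 3 → Bool))) : GL (Fin 3) F) = ((e ((x, 0), 0) : ↥(unipotentRadicalGL F (id : Fin 3 → Fin 3))) : GL (Fin 3) F)) ∧ ∀ a b, φ (a + b) = φ a * φ b := by
  have hc := coord_mem_iff e he
  have hval : Continuous fun γ : ↥(unipotentRadicalGL F (![false, true, true] : Fin 3 → Bool) ⊓ standardLeviGL F (![false, false, true] : Fin 3 → Bool)) => ((γ : GL (Fin 3) F) : Matrix (Fin 3) (Fin 3) F) := Units.continuous_val.comp continuous_subtype_val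
  refine ⟨{ toFun := fun x => ⟨((e ((x, 0), 0) : ↥(unipotentRadicalGL F (id : Fin 3 → Fin 3))) : GL (Fin 3) F), (hc _).2.2.1.2 ⟨rfl, rfl⟩⟩,
             invFun := fun γ => ((γ : GL (Fin 3) F) : Matrix (Fin 3) (Fin 3) F) 0 1,
             left_inv := fun x => (coord_apply e he _).1,
             right_inv := fun γ => ?_,
             continuous_toFun := (continuous_subtype_val.comp (e.continuous.comp (by fun_prop))).subtype_mk _,
             continuous_invFun := hval.matrix_elem 0 1 }, fun x => rfl, fun a b => ?_⟩
  · obtain ⟨hU, h12, h02⟩ := (mem_rootGroup_zeroOne_iff (γ : GL (Fin 3) F)).1 γ.2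
    apply Subtype.ext
    change ((e ((((γ : GL (Fin 3) F) : Matrix (Fin 3) (Fin 3) F) 0 1, 0), 0) : ↥(unipotentRadicalGL F (id : Fin 3 → Fin 3))) : GL (Fin 3) F) = (γ : GL (Fin 3) F)
    conv_rhs => rw [eq_coord e he (γ : GL (Fin 3) F) hU]
    rw [h12, h02]
  · apply Subtype.ext
    change ((e ((a + b, 0), 0) : ↥(unipotentRadicalGL F (id : Fin 3 → Fin 3))) : GL (Fin 3) F) = ((e ((a, 0), 0) : ↥(unipotentRadicalGL F (id : Fin 3 → Fin 3))) : GL (Fin 3) F) * ((e ((b, 0), 0) : ↥(unipotentRadicalGL F (id : Fin 3 → Fin 3))) : GL (Fin 3) F)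
    rw [← Subgroup.coe_mul, coord_mul e he]
    congr 2
    ext <;> simp

/-- `F ≃ₜ U_{α₂}`, `y ↦ e((0,y),0)`, additive. [cite: BernsteinZelevinsky1977, §2.1] -/
theorem exists_homeomorph_rootGroup_oneTwo :
    ∃ φ : F ≃ₜ ↥(unipotentRadicalGL F (![false, false, true] : Fin 3 → Bool) ⊓ standardLeviGL F (![false, true, true] : Fin 3 → Bool)),
      (∀ y, ((φ y : ↥(unipotentRadicalGL F (![false, false, true] : Fin 3 → Bool) ⊓ standardLeviGL F (![false, true, true] : Fin 3 → Bool))) : GL (Fin 3) F) = ((e ((0, y), 0) : ↥(unipotentRadicalGL F (id : Fin 3 → Fin 3))) : GL (Fin 3) F)) ∧ ∀ a b, φ (a + b) = φ a * φ b := by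
  have hc := coord_mem_iff e he
  have hval : Continuous fun γ : ↥(unipotentRadicalGL F (![false, false, true] : Fin 3 → Bool) ⊓ standardLeviGL F (![false, true, true] : Fin 3 → Bool)) => ((γ : GL (Fin 3) F) : Matrix (Fin 3) (Fin 3) F) := Units.continuous_val.comp continuous_subtype_val
  refine ⟨{ toFun := fun y => ⟨((e ((0, y), 0) : ↥(unipotentRadicalGL F (id : Fin 3 → Fin 3))) : GL (Fin 3) F), (hc _).2.2.2.2 ⟨rfl, rfl⟩⟩,
             invFun := fun γ => ((γ : GL (Fin 3) F) : Matrix (Fin 3) (Fin 3) F) 1 2,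
             left_inv := fun y => (coord_apply e he _).2.1,
             right_inv := fun γ => ?_,
             continuous_toFun := (continuous_subtype_val.comp (e.continuous.comp (by fun_prop))).subtype_mk _,
             continuous_invFun := hval.matrix_elem 1 2 }, fun y => rfl, fun a b => ?_⟩
  · obtain ⟨hU, h01, h02⟩ := (mem_rootGroup_oneTwo_iff (γ : GL (Fin 3) F)).1 γ.2
    apply Subtype.ext
    change ((e ((0, ((γ : GL (Fin 3) F) : Matrix (Fin 3) (Fin 3) F) 1 2), 0) : ↥(unipotentRadicalGL F (id : Fin 3 → Fin 3))) : GL (Fin 3) F) = (γ : GL (Fin 3) F)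
    conv_rhs => rw [eq_coord e he (γ : GL (Fin 3) F) hU]
    rw [h01, h02]
  · apply Subtype.ext
    change ((e ((0, a + b), 0) : ↥(unipotentRadicalGL F (id : Fin 3 → Fin 3))) : GL (Fin 3) F) = ((e ((0, a), 0) : ↥(unipotentRadicalGL F (id : Fin 3 → Fin 3))) : GL (Fin 3) F) * ((e ((0, b), 0) : ↥(unipotentRadicalGL F (id : Fin 3 → Fin 3))) : GL (Fin 3) F)
    rw [← Subgroup.coe_mul, coord_mul e he]
    congr 2
    ext <;> simp

/-- `F × F ≃ₜ U_Q`, `(y,z) ↦ e((0,y),z)`, additive. [cite: BernsteinZelevinsky1977, §2.1] -/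
theorem exists_homeomorph_unipotentRadicalGL_twoOne :
    ∃ φ : F × F ≃ₜ ↥(unipotentRadicalGL F (![false, false, true] : Fin 3 → Bool)),
      (∀ q, ((φ q : ↥(unipotentRadicalGL F (![false, false, true] : Fin 3 → Bool))) : GL (Fin 3) F) = ((e ((0, q.1), q.2) : ↥(unipotentRadicalGL F (id : Fin 3 → Fin 3))) : GL (Fin 3) F)) ∧ ∀ a b, φ (a + b) = φ a * φ b := by
  have hc := coord_mem_iff e he
  have hval : Continuous fun γ : ↥(unipotentRadicalGL F (![false, false, true] : Fin 3 → Bool)) => ((γ : GL (Fin 3) F) : Matrix (Fin 3) (Fin 3) F) := Units.continuous_val.comp continuous_subtype_val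
  refine ⟨{ toFun := fun q => ⟨((e ((0, q.1), q.2) : ↥(unipotentRadicalGL F (id : Fin 3 → Fin 3))) : GL (Fin 3) F), (hc _).1.2 rfl⟩,
             invFun := fun γ => (((γ : GL (Fin 3) F) : Matrix (Fin 3) (Fin 3) F) 1 2, ((γ : GL (Fin 3) F) : Matrix (Fin 3) (Fin 3) F) 0 2),
             left_inv := fun q => Prod.ext (coord_apply e he _).2.1 (coord_apply e he _).2.2,
             right_inv := fun γ => ?_,
             continuous_toFun := (continuous_subtype_val.comp (e.continuous.comp (by fun_prop))).subtype_mk _,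
             continuous_invFun := (hval.matrix_elem 1 2).prodMk (hval.matrix_elem 0 2) }, fun q => rfl, fun a b => ?_⟩
  · obtain ⟨hU, h01⟩ := (mem_unipotentRadicalGL_twoOne_iff (γ : GL (Fin 3) F)).1 γ.2
    apply Subtype.ext
    change ((e ((0, ((γ : GL (Fin 3) F) : Matrix (Fin 3) (Fin 3) F) 1 2), ((γ : GL (Fin 3) F) : Matrix (Fin 3) (Fin 3) F) 0 2) : ↥(unipotentRadicalGL F (id : Fin 3 → Fin 3))) : GL (Fin 3) F) = (γ : GL (Fin 3) F)
    conv_rhs => rw [eq_coord e he (γ : GL (Fin 3) F) hU]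
    rw [h01]
  · apply Subtype.ext
    change ((e ((0, (a + b).1), (a + b).2) : ↥(unipotentRadicalGL F (id : Fin 3 → Fin 3))) : GL (Fin 3) F) = ((e ((0, a.1), a.2) : ↥(unipotentRadicalGL F (id : Fin 3 → Fin 3))) : GL (Fin 3) F) * ((e ((0, b.1), b.2) : ↥(unipotentRadicalGL F (id : Fin 3 → Fin 3))) : GL (Fin 3) F)
    rw [← Subgroup.coe_mul, coord_mul e he]
    congr 2
    ext <;> simp

/-- `F × F ≃ₜ U_{Q′}`, `(x,z) ↦ e((x,0),z)`, additive. [cite: BernsteinZelevinsky1977, §2.1] -/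
theorem exists_homeomorph_unipotentRadicalGL_oneTwo :
    ∃ φ : F × F ≃ₜ ↥(unipotentRadicalGL F (![false, true, true] : Fin 3 → Bool)),
      (∀ q, ((φ q : ↥(unipotentRadicalGL F (![false, true, true] : Fin 3 → Bool))) : GL (Fin 3) F) = ((e ((q.1, 0), q.2) : ↥(unipotentRadicalGL F (id : Fin 3 → Fin 3))) : GL (Fin 3) F)) ∧ ∀ a b, φ (a + b) = φ a * φ b := by
  have hc := coord_mem_iff e he
  have hval : Continuous fun γ : ↥(unipotentRadicalGL F (![false, true, true] : Fin 3 → Bool)) => ((γ : GL (Fin 3) F) : Matrix (Fin 3) (Fin 3) F) := Units.continuous_val.comp continuous_subtype_val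
  refine ⟨{ toFun := fun q => ⟨((e ((q.1, 0), q.2) : ↥(unipotentRadicalGL F (id : Fin 3 → Fin 3))) : GL (Fin 3) F), (hc _).2.1.2 rfl⟩,
             invFun := fun γ => (((γ : GL (Fin 3) F) : Matrix (Fin 3) (Fin 3) F) 0 1, ((γ : GL (Fin 3) F) : Matrix (Fin 3) (Fin 3) F) 0 2),
             left_inv := fun q => Prod.ext (coord_apply e he _).1 (coord_apply e he _).2.2,
             right_inv := fun γ => ?_,
             continuous_toFun := (continuous_subtype_val.comp (e.continuous.comp (by fun_prop))).subtype_mk _,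
             continuous_invFun := (hval.matrix_elem 0 1).prodMk (hval.matrix_elem 0 2) }, fun q => rfl, fun a b => ?_⟩
  · obtain ⟨hU, h12⟩ := (mem_unipotentRadicalGL_oneTwo_iff (γ : GL (Fin 3) F)).1 γ.2
    apply Subtype.ext
    change ((e ((((γ : GL (Fin 3) F) : Matrix (Fin 3) (Fin 3) F) 0 1, 0), ((γ : GL (Fin 3) F) : Matrix (Fin 3) (Fin 3) F) 0 2) : ↥(unipotentRadicalGL F (id : Fin 3 → Fin 3))) : GL (Fin 3) F) = (γ : GL (Fin 3) F)
    conv_rhs => rw [eq_coord e he (γ : GL (Fin 3) F) hU]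
    rw [h12]
  · apply Subtype.ext
    change ((e (((a + b).1, 0), (a + b).2) : ↥(unipotentRadicalGL F (id : Fin 3 → Fin 3))) : GL (Fin 3) F) = ((e ((a.1, 0), a.2) : ↥(unipotentRadicalGL F (id : Fin 3 → Fin 3))) : GL (Fin 3) F) * ((e ((b.1, 0), b.2) : ↥(unipotentRadicalGL F (id : Fin 3 → Fin 3))) : GL (Fin 3) F)
    rw [← Subgroup.coe_mul, coord_mul e he]
    congr 2
    ext <;> simp

end Coord

/-- **Entries of a product in `U₃`**: `(sγ)₀₁ = s₀₁ + γ₀₁`, `(sγ)₁₂ = s₁₂ + γ₁₂`, `(sγ)₀₂ = s₀₂ + γ₀₂ + s₀₁ γ₁₂`. [folklore] -/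
theorem mul_apply_of_mem_upperUnitriangular {s γ : GL (Fin 3) F} (hs : s ∈ upperUnitriangular (Fin 3) F) (hγ : γ ∈ upperUnitriangular (Fin 3) F) :
    ((s * γ : GL (Fin 3) F) : Matrix (Fin 3) (Fin 3) F) 0 1 = (s : Matrix (Fin 3) (Fin 3) F) 0 1 + (γ : Matrix (Fin 3) (Fin 3) F) 0 1 ∧
    ((s * γ : GL (Fin 3) F) : Matrix (Fin 3) (Fin 3) F) 1 2 = (s : Matrix (Fin 3) (Fin 3) F) 1 2 + (γ : Matrix (Fin 3) (Fin 3) F) 1 2 ∧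
    ((s * γ : GL (Fin 3) F) : Matrix (Fin 3) (Fin 3) F) 0 2 = (s : Matrix (Fin 3) (Fin 3) F) 0 2 + (γ : Matrix (Fin 3) (Fin 3) F) 0 2 + (s : Matrix (Fin 3) (Fin 3) F) 0 1 * (γ : Matrix (Fin 3) (Fin 3) F) 1 2 := by
  have hs' := (mem_borelUnipotentGL3_iff s).1 hs
  have hγ' := (mem_borelUnipotentGL3_iff γ).1 hγ
  rw [Units.val_mul, hs', hγ']
  refine ⟨?_, ?_, ?_⟩ <;> (simp [Matrix.mul_apply, Fin.sum_univ_three]; try ring)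

/-! ## §3 Transport of measures along additive homeomorphisms; scalings of `μ_F ⊗ μ_F` -/

/-- **Transport of a Haar-type measure along an additive homeomorphism `φ : A ≃ₜ Γ`** (`φ(a+b) = φ a · φ b`): `φ_* ν` is finite on compacts, right invariant and
positive on non-empty open sets if `ν` is. [cite: BernsteinZelevinsky1977, 1.7] -/
theorem measure_map_addHomeomorph {A : Type*} [AddCommGroup A] [TopologicalSpace A] [IsTopologicalAddGroup A] [MeasurableSpace A] [BorelSpace A]
    {G : Type*} [Group G] [TopologicalSpace G] [IsTopologicalGroup G] {Γ : Subgroup G} [MeasurableSpace ↥Γ] [BorelSpace ↥Γ]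
    (φ : A ≃ₜ ↥Γ) (hφ : ∀ a b, φ (a + b) = φ a * φ b) (ν : Measure A) [IsFiniteMeasureOnCompacts ν] [ν.IsAddRightInvariant] [ν.IsOpenPosMeasure] :
    IsFiniteMeasureOnCompacts (ν.map φ) ∧ (ν.map φ).IsMulRightInvariant ∧ (ν.map φ).IsOpenPosMeasure := by
  have hme : MeasurableEmbedding φ := φ.measurableEmbedding
  have hmeas : Measurable φ := φ.continuous.measurable
  refine ⟨⟨fun K hK => ?_⟩, ⟨fun g => ?_⟩, ⟨fun U hU hne => ?_⟩⟩
  · rw [hme.map_apply]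
    exact (φ.isCompact_preimage.2 hK).measure_lt_top
  · obtain ⟨a, rfl⟩ := φ.surjective g
    have hcomp : (fun x : ↥Γ => x * φ a) ∘ φ = φ ∘ fun b => b + a := by
      funext b
      simp only [Function.comp_apply, hφ]
    rw [Measure.map_map (measurable_mul_const _) hmeas, hcomp, ← Measure.map_map hmeas (measurable_add_const a), map_add_right_eq_self]
  · rw [hme.map_apply]
    exact (hU.preimage φ.continuous).measure_ne_zero ν (hne.preimage φ.surjective)

section LocalField

variable [ValuativeRel F] [TopologicalSpace F] [IsNonarchimedeanLocalField F] [MeasurableSpace F] [BorelSpace F]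

/-- **The scaling `(y, z) ↦ (β y, γ z)` multiplies `μ_F ⊗ μ_F` by `‖β‖⁻¹ ‖γ‖⁻¹`** (★ `map_mul_left_addHaar` twice, `map_prod_map`). [cite: BernsteinZelevinsky1977, 1.7] -/
theorem map_prodScale (μF : Measure F) [μF.IsAddHaarMeasure] {β γ : F} (hβ : β ≠ 0) (hγ : γ ≠ 0) :
    (μF.prod μF).map (fun q : F × F => (β * q.1, γ * q.2)) = (((normAbs F β⁻¹ * normAbs F γ⁻¹ : ℝ≥0)) : ℝ≥0∞) • μF.prod μF := by
  haveI : T2Space F := (isLocalField F).toT2Space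
  haveI : LocallyCompactSpace F := (isLocalField F).toLocallyCompactSpace
  haveI : SecondCountableTopology F := secondCountableTopology_localField F
  have h : (fun q : F × F => (β * q.1, γ * q.2)) = Prod.map (fun x => β * x) (fun x => γ * x) := rfl
  rw [h, ← Measure.map_prod_map _ _ (measurable_const_mul β) (measurable_const_mul γ), map_mul_left_addHaar μF hβ, map_mul_left_addHaar μF hγ]
  simp only [Measure.prod_smul_left, Measure.prod_smul_right, smul_smul, ENNReal.coe_mul]
  rw [mul_comm]

end LocalField



/-! ## §4 The continuous retractions `proj_w : U → Γ_w` with `proj_w (s γ) = γ` (`s ∈ S_w`) -/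

section Proj

variable [TopologicalSpace F] [IsTopologicalRing F]

/-- Cell `s₁`: `proj(u) = e((u₀₁,0),0) ∈ U_{α₁}`; `proj(sγ) = γ` for `s ∈ U_Q`. [cite: Casselman1995, §6.3, Prop. 6.3.3] -/
theorem exists_proj_swap_zero_one :
    ∃ proj : ↥(upperUnitriangular (Fin 3) F) → ↥(unipotentRadicalGL F (![false, true, true] : Fin 3 → Bool) ⊓ standardLeviGL F (![false, false, true] : Fin 3 → Bool)), Continuous proj ∧
      ∀ (s : GL (Fin 3) F) (hs : s ∈ upperUnitriangular (Fin 3) F) (_ : s ∈ unipotentRadicalGL F (![false, false, true] : Fin 3 → Bool)) (γ : ↥(unipotentRadicalGL F (![false, true, true] : Fin 3 → Bool) ⊓ standardLeviGL F (![false, false, true] : Fin 3 → Bool))),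
        proj ⟨s * γ, Subgroup.mul_mem _ hs (rootSubgroups_le.2.2.1 γ.2)⟩ = γ := by
  obtain ⟨e, he⟩ := exists_coordHomeomorph (R := F)
  obtain ⟨φ, hφ, -⟩ := exists_homeomorph_rootGroup_zeroOne e he
  refine ⟨fun u => φ (((u : GL (Fin 3) F) : Matrix (Fin 3) (Fin 3) F) 0 1), φ.continuous.comp ((Units.continuous_val.comp continuous_subtype_val).matrix_elem 0 1), fun s hs hsS γ => ?_⟩
  obtain ⟨hU, h12, h02⟩ := (mem_rootGroup_zeroOne_iff (γ : GL (Fin 3) F)).1 γ.2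
  have h01 : ((s * (γ : GL (Fin 3) F) : GL (Fin 3) F) : Matrix (Fin 3) (Fin 3) F) 0 1 = ((γ : GL (Fin 3) F) : Matrix (Fin 3) (Fin 3) F) 0 1 := by
    rw [(mul_apply_of_mem_upperUnitriangular hs hU).1, ((mem_unipotentRadicalGL_twoOne_iff s).1 hsS).2, zero_add]
  apply Subtype.ext
  change ((φ (((s * (γ : GL (Fin 3) F) : GL (Fin 3) F) : Matrix (Fin 3) (Fin 3) F) 0 1) : ↥(unipotentRadicalGL F (![false, true, true] : Fin 3 → Bool) ⊓ standardLeviGL F (![false, false, true] : Fin 3 → Bool))) : GL (Fin 3) F) = (γ : GL (Fin 3) F)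
  rw [h01, hφ]
  conv_rhs => rw [eq_coord e he (γ : GL (Fin 3) F) hU]
  rw [h12, h02]

/-- Cell `s₂`: `proj(u) = e((0,u₁₂),0) ∈ U_{α₂}`; `proj(sγ) = γ` for `s ∈ U_{Q′}`. [cite: Casselman1995, §6.3, Prop. 6.3.3] -/
theorem exists_proj_swap_one_two :
    ∃ proj : ↥(upperUnitriangular (Fin 3) F) → ↥(unipotentRadicalGL F (![false, false, true] : Fin 3 → Bool) ⊓ standardLeviGL F (![false, true, true] : Fin 3 → Bool)), Continuous proj ∧
      ∀ (s : GL (Fin 3) F) (hs : s ∈ upperUnitriangular (Fin 3) F) (_ : s ∈ unipotentRadicalGL F (![false, true, true] : Fin 3 → Bool)) (γ : ↥(unipotentRadicalGL F (![false, false, true] : Fin 3 → Bool) ⊓ standardLeviGL F (![false, true, true] : Fin 3 → Bool))),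
        proj ⟨s * γ, Subgroup.mul_mem _ hs (rootSubgroups_le.2.2.2 γ.2)⟩ = γ := by
  obtain ⟨e, he⟩ := exists_coordHomeomorph (R := F)
  obtain ⟨φ, hφ, -⟩ := exists_homeomorph_rootGroup_oneTwo e he
  refine ⟨fun u => φ (((u : GL (Fin 3) F) : Matrix (Fin 3) (Fin 3) F) 1 2), φ.continuous.comp ((Units.continuous_val.comp continuous_subtype_val).matrix_elem 1 2), fun s hs hsS γ => ?_⟩
  obtain ⟨hU, h01, h02⟩ := (mem_rootGroup_oneTwo_iff (γ : GL (Fin 3) F)).1 γ.2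
  have h12 : ((s * (γ : GL (Fin 3) F) : GL (Fin 3) F) : Matrix (Fin 3) (Fin 3) F) 1 2 = ((γ : GL (Fin 3) F) : Matrix (Fin 3) (Fin 3) F) 1 2 := by
    rw [(mul_apply_of_mem_upperUnitriangular hs hU).2.1, ((mem_unipotentRadicalGL_oneTwo_iff s).1 hsS).2, zero_add]
  apply Subtype.ext
  change ((φ (((s * (γ : GL (Fin 3) F) : GL (Fin 3) F) : Matrix (Fin 3) (Fin 3) F) 1 2) : ↥(unipotentRadicalGL F (![false, false, true] : Fin 3 → Bool) ⊓ standardLeviGL F (![false, true, true] : Fin 3 → Bool))) : GL (Fin 3) F) = (γ : GL (Fin 3) F)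
  rw [h12, hφ]
  conv_rhs => rw [eq_coord e he (γ : GL (Fin 3) F) hU]
  rw [h01, h02]

/-- Cell `s₁s₂`: `proj(u) = e((u₀₁,0),u₀₂) ∈ U_{Q′}`; `proj(sγ) = γ` for `s ∈ U_{α₂}`. [cite: Casselman1995, §6.3, Prop. 6.3.3] -/
theorem exists_proj_cycle_one_two_zero :
    ∃ proj : ↥(upperUnitriangular (Fin 3) F) → ↥(unipotentRadicalGL F (![false, true, true] : Fin 3 → Bool)), Continuous proj ∧
      ∀ (s : GL (Fin 3) F) (hs : s ∈ upperUnitriangular (Fin 3) F) (_ : s ∈ unipotentRadicalGL F (![false, false, true] : Fin 3 → Bool) ⊓ standardLeviGL F (![false, true, true] : Fin 3 → Bool)) (γ : ↥(unipotentRadicalGL F (![false, true, true] : Fin 3 → Bool))),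
        proj ⟨s * γ, Subgroup.mul_mem _ hs (rootSubgroups_le.2.1 γ.2)⟩ = γ := by
  obtain ⟨e, he⟩ := exists_coordHomeomorph (R := F)
  obtain ⟨φ, hφ, -⟩ := exists_homeomorph_unipotentRadicalGL_oneTwo e he
  have hval : Continuous fun u : ↥(upperUnitriangular (Fin 3) F) => ((u : GL (Fin 3) F) : Matrix (Fin 3) (Fin 3) F) := Units.continuous_val.comp continuous_subtype_val
  refine ⟨fun u => φ (((u : GL (Fin 3) F) : Matrix (Fin 3) (Fin 3) F) 0 1, ((u : GL (Fin 3) F) : Matrix (Fin 3) (Fin 3) F) 0 2), φ.continuous.comp ((hval.matrix_elem 0 1).prodMk (hval.matrix_elem 0 2)),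
    fun s hs hsS γ => ?_⟩
  obtain ⟨hU, h12⟩ := (mem_unipotentRadicalGL_oneTwo_iff (γ : GL (Fin 3) F)).1 γ.2
  obtain ⟨-, hs01, hs02⟩ := (mem_rootGroup_oneTwo_iff s).1 hsS
  obtain ⟨hm01, -, hm02⟩ := mul_apply_of_mem_upperUnitriangular hs hU
  have h01 : ((s * (γ : GL (Fin 3) F) : GL (Fin 3) F) : Matrix (Fin 3) (Fin 3) F) 0 1 = ((γ : GL (Fin 3) F) : Matrix (Fin 3) (Fin 3) F) 0 1 := by rw [hm01, hs01, zero_add]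
  have h02 : ((s * (γ : GL (Fin 3) F) : GL (Fin 3) F) : Matrix (Fin 3) (Fin 3) F) 0 2 = ((γ : GL (Fin 3) F) : Matrix (Fin 3) (Fin 3) F) 0 2 := by rw [hm02, hs02, hs01, zero_add, zero_mul, add_zero]
  apply Subtype.ext
  change ((φ (((s * (γ : GL (Fin 3) F) : GL (Fin 3) F) : Matrix (Fin 3) (Fin 3) F) 0 1, ((s * (γ : GL (Fin 3) F) : GL (Fin 3) F) : Matrix (Fin 3) (Fin 3) F) 0 2) : ↥(unipotentRadicalGL F (![false, true, true] : Fin 3 → Bool))) : GL (Fin 3) F) = (γ : GL (Fin 3) F)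
  rw [h01, h02, hφ]
  conv_rhs => rw [eq_coord e he (γ : GL (Fin 3) F) hU]
  rw [h12]

/-- Cell `s₂s₁`: `proj(u) = e((0,u₁₂), u₀₂ − u₀₁u₁₂) ∈ U_Q`; `proj(sγ) = γ` for `s ∈ U_{α₁}`. [cite: Casselman1995, §6.3, Prop. 6.3.3] -/
theorem exists_proj_cycle_two_zero_one :
    ∃ proj : ↥(upperUnitriangular (Fin 3) F) → ↥(unipotentRadicalGL F (![false, false, true] : Fin 3 → Bool)), Continuous proj ∧
      ∀ (s : GL (Fin 3) F) (hs : s ∈ upperUnitriangular (Fin 3) F) (_ : s ∈ unipotentRadicalGL F (![false, true, true] : Fin 3 → Bool) ⊓ standardLeviGL F (![false, false, true] : Fin 3 → Bool)) (γ : ↥(unipotentRadicalGL F (![false, false, true] : Fin 3 → Bool))),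
        proj ⟨s * γ, Subgroup.mul_mem _ hs (rootSubgroups_le.1 γ.2)⟩ = γ := by
  obtain ⟨e, he⟩ := exists_coordHomeomorph (R := F)
  obtain ⟨φ, hφ, -⟩ := exists_homeomorph_unipotentRadicalGL_twoOne e he
  have hval : Continuous fun u : ↥(upperUnitriangular (Fin 3) F) => ((u : GL (Fin 3) F) : Matrix (Fin 3) (Fin 3) F) := Units.continuous_val.comp continuous_subtype_val
  refine ⟨fun u => φ (((u : GL (Fin 3) F) : Matrix (Fin 3) (Fin 3) F) 1 2, ((u : GL (Fin 3) F) : Matrix (Fin 3) (Fin 3) F) 0 2 - ((u : GL (Fin 3) F) : Matrix (Fin 3) (Fin 3) F) 0 1 * ((u : GL (Fin 3) F) : Matrix (Fin 3) (Fin 3) F) 1 2),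
    φ.continuous.comp ((hval.matrix_elem 1 2).prodMk ((hval.matrix_elem 0 2).sub ((hval.matrix_elem 0 1).mul (hval.matrix_elem 1 2)))),
    fun s hs hsS γ => ?_⟩
  obtain ⟨hU, h01⟩ := (mem_unipotentRadicalGL_twoOne_iff (γ : GL (Fin 3) F)).1 γ.2
  obtain ⟨-, hs12, hs02⟩ := (mem_rootGroup_zeroOne_iff s).1 hsS
  obtain ⟨hm01, hm12, hm02⟩ := mul_apply_of_mem_upperUnitriangular hs hU
  have h12 : ((s * (γ : GL (Fin 3) F) : GL (Fin 3) F) : Matrix (Fin 3) (Fin 3) F) 1 2 = ((γ : GL (Fin 3) F) : Matrix (Fin 3) (Fin 3) F) 1 2 := by rw [hm12, hs12, zero_add]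
  have h02 : ((s * (γ : GL (Fin 3) F) : GL (Fin 3) F) : Matrix (Fin 3) (Fin 3) F) 0 2 - ((s * (γ : GL (Fin 3) F) : GL (Fin 3) F) : Matrix (Fin 3) (Fin 3) F) 0 1 * ((s * (γ : GL (Fin 3) F) : GL (Fin 3) F) : Matrix (Fin 3) (Fin 3) F) 1 2 =
      ((γ : GL (Fin 3) F) : Matrix (Fin 3) (Fin 3) F) 0 2 := by
    rw [hm02, hm01, hm12, hs02, hs12, h01]; ring
  apply Subtype.ext
  change ((φ (((s * (γ : GL (Fin 3) F) : GL (Fin 3) F) : Matrix (Fin 3) (Fin 3) F) 1 2, ((s * (γ : GL (Fin 3) F) : GL (Fin 3) F) : Matrix (Fin 3) (Fin 3) F) 0 2 - ((s * (γ : GL (Fin 3) F) : GL (Fin 3) F) : Matrix (Fin 3) (Fin 3) F) 0 1 * ((s * (γ : GL (Fin 3) F) : GL (Fin 3) F) : Matrix (Fin 3) (Fin 3) F) 1 2) :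
      ↥(unipotentRadicalGL F (![false, false, true] : Fin 3 → Bool))) : GL (Fin 3) F) = (γ : GL (Fin 3) F)
  rw [h02, h12, hφ]
  conv_rhs => rw [eq_coord e he (γ : GL (Fin 3) F) hU]
  rw [h01]

end Proj

end Summit.HodgeConjecture.HodgeConjecture.Cruxes.H413.K2E3GL3BruhatCellHaar
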